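import Summits.QuantumFields.BalabanUV.Beta.GAN24.ExponentialChartHessianMoments

/-!
# `BalabanUV.Beta.GAN24.ExponentialChartHessianMomentsEnd` — binder row G-an2-4 ∕ (CONV-C), route R7 «TWO CURRENCIES», PART 260: THE β-TYPE NUMBERS OF THE ONE-LOOP HESSIAN ADD IN
# THE BACKGROUND, DISPLAYING ONLY `(α, β)` AND EL₁.  PART 259 §2 proved, for ANY infinite-volume limit kernels of PART 254's Hessian families of `(A₁, B)`, `(A₂, B)`, `(A₁ + A₂, B)`,
# additivity of the (1.22) second moments at every level under (UD) and at the limit under the END's rates; PART 254's END supplies every one of these hypotheses for volume-indexed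
# REAL Lipschitz connections with pointwise limits — so the corollary displays only `(α, β)` and EL₁ of `A₁, A₂, B` (the sum background is Lipschitz `(2α, 2β)` by PART 253's
# `lipschitzBackground_add`, `B` is re-read at `(2α, 2β)` by `lipschitzBackground_mono`; `κ∕d > 0`; `θ = √(L⁻¹) < 1`) (unit b2b-balaban-gan24-p3, gen 67; v1; generator
# `HOME/b2b-balaban-gan24-p3/gen67/records/gen/gen259.py`)

NOT IN PRINT; OUR PROOF ([folklore] bookkeeping BY NAME over PART 259 (`hessianMoments_add_left`), PART 254 (`conv_deriv_deriv_invCov_expChart₂_of_tendsto`), PART 253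
(`lipschitzBackground_add ∕ _mono`), Mathlib's `Real.sqrt_lt_sqrt`, `Complex.ofReal_add`; [Balaban1987RG1] (1.20)–(1.22) p. 264 LOCATE the shapes; nothing printed is a hypothesis).
HONEST FRAMING (cell contract, verbatim): «discharging `BetaPertH` makes Bałaban's UV stability UNCONDITIONAL — a real constructive-QFT result; it is NOT the
continuum limit and NOT the Clay problem.»  HONEST DEPENDENCY (verbatim): «continuum YM on T⁴ ⇐ BetaPertH ∧ nine spine estimates (0/9 proved); BetaPertH ⇐
(D1) ∧ (D4) ∧ CAP+tail; G-an2-4 gates asym, D1 and NE2/3/4.»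

WHAT THIS FILE PROVES (0 sorry, 0 `def`; `d ≥ 3`, `L ≥ 2`, `a > 0`, `μ ≠ ν`, even cubic volumes `2(t+1)`):
* **`exists_hessianMoments_add_left_of_tendsto`**: for volume-indexed REAL `A₁, A₂, B`, each `LipschitzBackground (α, β)` uniformly in `t`, with EL₁, there are limit kernels
  `Π₁, Π₂, Π₁₂` of the three Hessian families with `Σ_xΠ₁₂,_k x_μx_ν = Σ_xΠ₁,_k x_μx_ν + Σ_xΠ₂,_k x_μx_ν` at every level `k` AND for the telescoped limit kernels;
  `exists_hessianMoments_add_right_of_tendsto` (the same in the second background).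
WHAT IT DOES NOT DO: the other laws at the END (symmetry ∕ homogeneity ∕ the diagonal need no analytic input — PART 259 §2 as stated); base points `U₀ ≠ 1`; colour; Bałaban's
`−∂P∂*` ∕ `aQ(U)*Q(U)` parts.  SUPPLIER work; NEVER «G-an2-4 closed»; NOT (CONV-C), NOT D1, NOT `BetaPertH`, NOT continuum, NOT Clay.  Records: `HOME/b2b-balaban-gan24-p3/gen67/README.md`.
-/

noncomputable section

open scoped BigOperators ComplexConjugate Matrix Matrix.Norms.L2Operator
open Filter Topology

namespace Summit.QuantumFields.BalabanUV.Beta.GAN24.ExponentialChartHessianMomentsEnd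

open Literature.MathematicalPhysics.QuantumFieldTheory.Balaban1983to89
open Literature.MathematicalPhysics.QuantumFieldTheory.Balaban1983to89.B5Prop11Plancherel (Tor fine)
open Literature.MathematicalPhysics.QuantumFieldTheory.Balaban1983to89.B5G183RateUnitTower (lev)
open Literature.MathematicalPhysics.QuantumFieldTheory.Balaban1983to89.Beta (Site IsInfiniteVolumeLimit)
open Literature.MathematicalPhysics.QuantumFieldTheory.Balaban1983to89.Beta.FreeLegDictionary (cubic)
open Literature.MathematicalPhysics.QuantumFieldTheory.Balaban1983to89.Beta.BlockKernelVolumeSockets (evenPeriod)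
open Literature.MathematicalPhysics.QuantumFieldTheory.Balaban1983to89.Beta.VectorTails (castT)
open Literature.MathematicalPhysics.QuantumFieldTheory.Balaban1983to89.Beta.LimitRate (UniformDecay StepRate limKernelOf)
open Summit.QuantumFields.BalabanUV.T4Continuum
open Summit.QuantumFields.BalabanUV.T4Continuum.CovariantAveragingTower (avgTow)
open Summit.QuantumFields.BalabanUV.T4Continuum.BalabanAveragedTowerUnit (idx QBlev)
open Summit.QuantumFields.BalabanUV.T4Continuum.BalabanAveragedCoerciveTower (unitIdx)
open Summit.QuantumFields.BalabanUV.T4Continuum.KingPairingPlantedLaw (calDalev)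
open Summit.QuantumFields.BalabanUV.T4Continuum.FirstOrderBackgroundModel (LipschitzBackground)
open Summit.QuantumFields.BalabanUV.T4Continuum.AbelianCovariantLaplacian (covPert)
open Summit.QuantumFields.BalabanUV.Beta.GAN24.ExponentialChartMixedBackgrounds (lipschitzBackground_add lipschitzBackground_mono)
open Summit.QuantumFields.BalabanUV.Beta.GAN24.ExponentialChartMixedCovariantTaylor (conv_deriv_deriv_invCov_expChart₂_of_tendsto)
open Summit.QuantumFields.BalabanUV.Beta.GAN24.ExponentialChartHessianMoments (hessianMoments_add_left hessianMoments_add_right)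

/-! ## §1 OVER PART 254's END: additivity of the β-type numbers in either background, displaying only `(α, β)` and EL₁ -/

section End

variable {d : ℕ} (L : ℕ) [NeZero L] (a : ℝ) (ha : 0 < a)

/-- **`exists_hessianMoments_add_left_of_tendsto` — THE β-TYPE NUMBERS OF THE ONE-LOOP HESSIAN ADD IN THE BACKGROUND, DISPLAYING ONLY `(α, β)` AND EL₁** [our proof] (`d ≥ 3`,
`L ≥ 2`, `a > 0`, `μ ≠ ν`, even cubic volumes `2(t+1)`): for volume-indexed REAL `A₁, A₂, B`, each `LipschitzBackground (α, β)` uniformly in `t`, with pointwise limits at the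
fine integer readings, PART 254 supplies limit kernels `Π₁, Π₂, Π₁₂` of the Hessian families of `(A₁, B)`, `(A₂, B)`, `(A₁ + A₂, B)` (the last two at the common constants
`(2α, 2β)`, PART 253's `lipschitzBackground_add ∕ _mono`) with (UD) at `κ∕d > 0` and the rate at `θ = √(L⁻¹) < 1`; §2 then gives additivity at every level AND at the limit.
[cite: Balaban1987RG1, (1.20)–(1.22) p.264 (shapes)] -/
theorem exists_hessianMoments_add_left_of_tendsto (hL : 2 ≤ L) (hd : 3 ≤ d) {μ ν : Fin d} (hne : μ ≠ ν) {α β : ℝ} {A₁ A₂ B : (t : ℕ) → (k : ℕ) → Fin d → (idx L (cubic d (evenPeriod t)) k → ℝ)}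
    (hA₁ : ∀ t, LipschitzBackground L (cubic d (evenPeriod t)) (fun k ν' x => (A₁ t k ν' x : ℂ)) α β)
    (hA₂ : ∀ t, LipschitzBackground L (cubic d (evenPeriod t)) (fun k ν' x => (A₂ t k ν' x : ℂ)) α β)
    (hB : ∀ t, LipschitzBackground L (cubic d (evenPeriod t)) (fun k ν' x => (B t k ν' x : ℂ)) α β)
    (hA₁1 : ∀ k (ν' f : Fin d) (z : Fin d → ℤ), ∃ s' : ℂ, Tendsto (fun t => ((A₁ t k ν' (castT (cubic d (lev L k * evenPeriod t)) z, f) : ℝ) : ℂ)) atTop (𝓝 s'))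
    (hA₂1 : ∀ k (ν' f : Fin d) (z : Fin d → ℤ), ∃ s' : ℂ, Tendsto (fun t => ((A₂ t k ν' (castT (cubic d (lev L k * evenPeriod t)) z, f) : ℝ) : ℂ)) atTop (𝓝 s'))
    (hB1 : ∀ k (ν' f : Fin d) (z : Fin d → ℤ), ∃ s' : ℂ, Tendsto (fun t => ((B t k ν' (castT (cubic d (lev L k * evenPeriod t)) z, f) : ℝ) : ℂ)) atTop (𝓝 s')) :
    ∃ P₁ P₂ P₁₂ : ℕ → B12Beta.Kernel d,
      (∀ k, IsInfiniteVolumeLimit evenPeriod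
      (fun t μ' ν' (z : Site d (evenPeriod t)) =>
          ((deriv (fun r : ℝ => deriv (fun s : ℝ => (avgTow (QBlev L (cubic d (evenPeriod t))) ((L : ℝ) ^ d)
          (fun k' => (calDalev L (cubic d (evenPeriod t)) a ha k' + covPert L (cubic d (evenPeriod t)) (fun k'' ν' (x' : idx L (cubic d (evenPeriod t)) k'') => Complex.exp
                ((Complex.I * ((A₁ t k'' ν' x' : ℝ) : ℂ) / ((lev L k'' : ℕ) : ℂ)) * ((s : ℝ) : ℂ) + (Complex.I * ((B t k'' ν' x' : ℝ) : ℂ) / ((lev L k'' : ℕ) : ℂ)) * ((r : ℝ) :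
                ℂ))) k')⁻¹) k)⁻¹) 0) 0)
            ((unitIdx L (cubic d (evenPeriod t))).symm (z, μ')) ((unitIdx L (cubic d (evenPeriod t))).symm (0, ν'))).re) (P₁ k)) ∧
      (∀ k, IsInfiniteVolumeLimit evenPeriod
      (fun t μ' ν' (z : Site d (evenPeriod t)) =>
          ((deriv (fun r : ℝ => deriv (fun s : ℝ => (avgTow (QBlev L (cubic d (evenPeriod t))) ((L : ℝ) ^ d)
          (fun k' => (calDalev L (cubic d (evenPeriod t)) a ha k' + covPert L (cubic d (evenPeriod t)) (fun k'' ν' (x' : idx L (cubic d (evenPeriod t)) k'') => Complex.exp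
                ((Complex.I * ((A₂ t k'' ν' x' : ℝ) : ℂ) / ((lev L k'' : ℕ) : ℂ)) * ((s : ℝ) : ℂ) + (Complex.I * ((B t k'' ν' x' : ℝ) : ℂ) / ((lev L k'' : ℕ) : ℂ)) * ((r : ℝ) :
                ℂ))) k')⁻¹) k)⁻¹) 0) 0)
            ((unitIdx L (cubic d (evenPeriod t))).symm (z, μ')) ((unitIdx L (cubic d (evenPeriod t))).symm (0, ν'))).re) (P₂ k)) ∧
      (∀ k, IsInfiniteVolumeLimit evenPeriod
      (fun t μ' ν' (z : Site d (evenPeriod t)) =>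
          ((deriv (fun r : ℝ => deriv (fun s : ℝ => (avgTow (QBlev L (cubic d (evenPeriod t))) ((L : ℝ) ^ d)
          (fun k' => (calDalev L (cubic d (evenPeriod t)) a ha k' + covPert L (cubic d (evenPeriod t)) (fun k'' ν' (x' : idx L (cubic d (evenPeriod t)) k'') => Complex.exp
                ((Complex.I * ((A₁ t k'' ν' x' + A₂ t k'' ν' x' : ℝ) : ℂ) / ((lev L k'' : ℕ) : ℂ)) * ((s : ℝ) : ℂ) + (Complex.I * ((B t k'' ν' x' : ℝ) : ℂ) / ((lev L k'' : ℕ) : ℂ)) * ((r : ℝ) :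
                ℂ))) k')⁻¹) k)⁻¹) 0) 0)
            ((unitIdx L (cubic d (evenPeriod t))).symm (z, μ')) ((unitIdx L (cubic d (evenPeriod t))).symm (0, ν'))).re) (P₁₂ k)) ∧
      (∀ k, B12Beta.secondMoment (P₁₂ k) μ ν = B12Beta.secondMoment (P₁ k) μ ν + B12Beta.secondMoment (P₂ k) μ ν) ∧
      B12Beta.secondMoment (limKernelOf P₁₂) μ ν = B12Beta.secondMoment (limKernelOf P₁) μ ν + B12Beta.secondMoment (limKernelOf P₂) μ ν := by
  have hα : 0 ≤ α := (hA₁ 0).nonneg.1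
  have hβ : 0 ≤ β := (hA₁ 0).nonneg.2
  have hd0 : (0 : ℝ) < d := by exact_mod_cast (lt_of_lt_of_le (by norm_num) hd : 0 < d)
  have hL1 : (1 : ℝ) < L := by exact_mod_cast (lt_of_lt_of_le one_lt_two hL : 1 < L)
  have hθ0 : 0 ≤ Real.sqrt ((L : ℝ)⁻¹) := Real.sqrt_nonneg _
  have hθ1 : Real.sqrt ((L : ℝ)⁻¹) < 1 := by
    rw [show (1 : ℝ) = Real.sqrt 1 from Real.sqrt_one.symm]
    exact Real.sqrt_lt_sqrt (inv_nonneg.mpr (Nat.cast_nonneg _)) (inv_lt_one_of_one_lt₀ hL1)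
  -- the sum background: Lipschitz `(2α, 2β)`, EL₁
  have hA : ∀ t, LipschitzBackground L (cubic d (evenPeriod t)) (fun k ν' x => ((A₁ t k ν' x + A₂ t k ν' x : ℝ) : ℂ)) (α + α) (β + β) := fun t => by
    have e : (fun k ν' (x : idx L (cubic d (evenPeriod t)) k) => ((A₁ t k ν' x + A₂ t k ν' x : ℝ) : ℂ))
        = fun k ν' x => (A₁ t k ν' x : ℂ) + (A₂ t k ν' x : ℂ) := by
      funext k ν' x
      push_cast
      rfl
    rw [e]
    exact lipschitzBackground_add L _ (hA₁ t) (hA₂ t)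
  have hB' : ∀ t, LipschitzBackground L (cubic d (evenPeriod t)) (fun k ν' x => (B t k ν' x : ℂ)) (α + α) (β + β) := fun t =>
    lipschitzBackground_mono L _ (hB t) (by linarith) (by linarith)
  have hA1 : ∀ k (ν' f : Fin d) (z : Fin d → ℤ), ∃ s' : ℂ,
      Tendsto (fun t => ((A₁ t k ν' (castT (cubic d (lev L k * evenPeriod t)) z, f) + A₂ t k ν' (castT (cubic d (lev L k * evenPeriod t)) z, f) : ℝ) : ℂ)) atTop (𝓝 s') := by
    intro k ν' f z
    obtain ⟨s₁, h₁⟩ := hA₁1 k ν' f z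
    obtain ⟨s₂, h₂⟩ := hA₂1 k ν' f z
    exact ⟨s₁ + s₂, (h₁.add h₂).congr fun t => (Complex.ofReal_add _ _).symm⟩
  obtain ⟨κ₁, C₁, C₁', hκ₁, -, -, P₁, hI₁, hU₁, -, -, hr₁⟩ := conv_deriv_deriv_invCov_expChart₂_of_tendsto L a ha hL hd hne hA₁ hB hA₁1 hB1
  obtain ⟨κ₂, C₂, C₂', hκ₂, -, -, P₂, hI₂, hU₂, -, -, hr₂⟩ := conv_deriv_deriv_invCov_expChart₂_of_tendsto L a ha hL hd hne hA₂ hB hA₂1 hB1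
  obtain ⟨κ₁₂, C₁₂, C₁₂', hκ₁₂, -, -, P₁₂, hI₁₂, -, -, -, hr₁₂⟩ := conv_deriv_deriv_invCov_expChart₂_of_tendsto L a ha hL hd hne hA hB' hA1 hB1
  have hadd := hessianMoments_add_left L a ha hI₁ hI₂ hI₁₂ hU₁ (div_pos hκ₁ hd0) hU₂ (div_pos hκ₂ hd0)
  exact ⟨P₁, P₂, P₁₂, hI₁, hI₂, hI₁₂, hadd.1, hadd.2 hθ0 hθ1 hr₁ hr₂ hr₁₂⟩


/-- `exists_hessianMoments_add_right_of_tendsto` — the same in the SECOND background: limit kernels of the Hessian families of `(A, B₁)`, `(A, B₂)`, `(A, B₁ + B₂)` whose β-type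
numbers add at every level and at the limit, displaying only `(α, β)` and EL₁ (PART 259's `hessianMoments_add_right` over PART 254). [our proof] -/
theorem exists_hessianMoments_add_right_of_tendsto (hL : 2 ≤ L) (hd : 3 ≤ d) {μ ν : Fin d} (hne : μ ≠ ν) {α β : ℝ} {A B₁ B₂ : (t : ℕ) → (k : ℕ) → Fin d → (idx L (cubic d (evenPeriod t)) k → ℝ)}
    (hA : ∀ t, LipschitzBackground L (cubic d (evenPeriod t)) (fun k ν' x => (A t k ν' x : ℂ)) α β)
    (hB₁ : ∀ t, LipschitzBackground L (cubic d (evenPeriod t)) (fun k ν' x => (B₁ t k ν' x : ℂ)) α β)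
    (hB₂ : ∀ t, LipschitzBackground L (cubic d (evenPeriod t)) (fun k ν' x => (B₂ t k ν' x : ℂ)) α β)
    (hA1 : ∀ k (ν' f : Fin d) (z : Fin d → ℤ), ∃ s' : ℂ, Tendsto (fun t => ((A t k ν' (castT (cubic d (lev L k * evenPeriod t)) z, f) : ℝ) : ℂ)) atTop (𝓝 s'))
    (hB₁1 : ∀ k (ν' f : Fin d) (z : Fin d → ℤ), ∃ s' : ℂ, Tendsto (fun t => ((B₁ t k ν' (castT (cubic d (lev L k * evenPeriod t)) z, f) : ℝ) : ℂ)) atTop (𝓝 s'))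
    (hB₂1 : ∀ k (ν' f : Fin d) (z : Fin d → ℤ), ∃ s' : ℂ, Tendsto (fun t => ((B₂ t k ν' (castT (cubic d (lev L k * evenPeriod t)) z, f) : ℝ) : ℂ)) atTop (𝓝 s')) :
    ∃ P₁ P₂ P₁₂ : ℕ → B12Beta.Kernel d,
      (∀ k, IsInfiniteVolumeLimit evenPeriod
      (fun t μ' ν' (z : Site d (evenPeriod t)) =>
          ((deriv (fun r : ℝ => deriv (fun s : ℝ => (avgTow (QBlev L (cubic d (evenPeriod t))) ((L : ℝ) ^ d)
          (fun k' => (calDalev L (cubic d (evenPeriod t)) a ha k' + covPert L (cubic d (evenPeriod t)) (fun k'' ν' (x' : idx L (cubic d (evenPeriod t)) k'') => Complex.exp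
                ((Complex.I * ((A t k'' ν' x' : ℝ) : ℂ) / ((lev L k'' : ℕ) : ℂ)) * ((s : ℝ) : ℂ) + (Complex.I * ((B₁ t k'' ν' x' : ℝ) : ℂ) / ((lev L k'' : ℕ) : ℂ)) * ((r : ℝ) :
                ℂ))) k')⁻¹) k)⁻¹) 0) 0)
            ((unitIdx L (cubic d (evenPeriod t))).symm (z, μ')) ((unitIdx L (cubic d (evenPeriod t))).symm (0, ν'))).re) (P₁ k)) ∧
      (∀ k, IsInfiniteVolumeLimit evenPeriod
      (fun t μ' ν' (z : Site d (evenPeriod t)) =>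
          ((deriv (fun r : ℝ => deriv (fun s : ℝ => (avgTow (QBlev L (cubic d (evenPeriod t))) ((L : ℝ) ^ d)
          (fun k' => (calDalev L (cubic d (evenPeriod t)) a ha k' + covPert L (cubic d (evenPeriod t)) (fun k'' ν' (x' : idx L (cubic d (evenPeriod t)) k'') => Complex.exp
                ((Complex.I * ((A t k'' ν' x' : ℝ) : ℂ) / ((lev L k'' : ℕ) : ℂ)) * ((s : ℝ) : ℂ) + (Complex.I * ((B₂ t k'' ν' x' : ℝ) : ℂ) / ((lev L k'' : ℕ) : ℂ)) * ((r : ℝ) :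
                ℂ))) k')⁻¹) k)⁻¹) 0) 0)
            ((unitIdx L (cubic d (evenPeriod t))).symm (z, μ')) ((unitIdx L (cubic d (evenPeriod t))).symm (0, ν'))).re) (P₂ k)) ∧
      (∀ k, IsInfiniteVolumeLimit evenPeriod
      (fun t μ' ν' (z : Site d (evenPeriod t)) =>
          ((deriv (fun r : ℝ => deriv (fun s : ℝ => (avgTow (QBlev L (cubic d (evenPeriod t))) ((L : ℝ) ^ d)
          (fun k' => (calDalev L (cubic d (evenPeriod t)) a ha k' + covPert L (cubic d (evenPeriod t)) (fun k'' ν' (x' : idx L (cubic d (evenPeriod t)) k'') => Complex.exp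
                ((Complex.I * ((A t k'' ν' x' : ℝ) : ℂ) / ((lev L k'' : ℕ) : ℂ)) * ((s : ℝ) : ℂ) + (Complex.I * ((B₁ t k'' ν' x' + B₂ t k'' ν' x' : ℝ) : ℂ) / ((lev L k'' : ℕ) : ℂ)) * ((r : ℝ) :
                ℂ))) k')⁻¹) k)⁻¹) 0) 0)
            ((unitIdx L (cubic d (evenPeriod t))).symm (z, μ')) ((unitIdx L (cubic d (evenPeriod t))).symm (0, ν'))).re) (P₁₂ k)) ∧
      (∀ k, B12Beta.secondMoment (P₁₂ k) μ ν = B12Beta.secondMoment (P₁ k) μ ν + B12Beta.secondMoment (P₂ k) μ ν) ∧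
      B12Beta.secondMoment (limKernelOf P₁₂) μ ν = B12Beta.secondMoment (limKernelOf P₁) μ ν + B12Beta.secondMoment (limKernelOf P₂) μ ν := by
  have hα : 0 ≤ α := (hA 0).nonneg.1
  have hβ : 0 ≤ β := (hA 0).nonneg.2
  have hd0 : (0 : ℝ) < d := by exact_mod_cast (lt_of_lt_of_le (by norm_num) hd : 0 < d)
  have hL1 : (1 : ℝ) < L := by exact_mod_cast (lt_of_lt_of_le one_lt_two hL : 1 < L)
  have hθ0 : 0 ≤ Real.sqrt ((L : ℝ)⁻¹) := Real.sqrt_nonneg _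
  have hθ1 : Real.sqrt ((L : ℝ)⁻¹) < 1 := by
    rw [show (1 : ℝ) = Real.sqrt 1 from Real.sqrt_one.symm]
    exact Real.sqrt_lt_sqrt (inv_nonneg.mpr (Nat.cast_nonneg _)) (inv_lt_one_of_one_lt₀ hL1)
  have hB : ∀ t, LipschitzBackground L (cubic d (evenPeriod t)) (fun k ν' x => ((B₁ t k ν' x + B₂ t k ν' x : ℝ) : ℂ)) (α + α) (β + β) := fun t => by
    have e : (fun k ν' (x : idx L (cubic d (evenPeriod t)) k) => ((B₁ t k ν' x + B₂ t k ν' x : ℝ) : ℂ))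
        = fun k ν' x => (B₁ t k ν' x : ℂ) + (B₂ t k ν' x : ℂ) := by
      funext k ν' x
      push_cast
      rfl
    rw [e]
    exact lipschitzBackground_add L _ (hB₁ t) (hB₂ t)
  have hA' : ∀ t, LipschitzBackground L (cubic d (evenPeriod t)) (fun k ν' x => (A t k ν' x : ℂ)) (α + α) (β + β) := fun t =>
    lipschitzBackground_mono L _ (hA t) (by linarith) (by linarith)
  have hB1 : ∀ k (ν' f : Fin d) (z : Fin d → ℤ), ∃ s' : ℂ,
      Tendsto (fun t => ((B₁ t k ν' (castT (cubic d (lev L k * evenPeriod t)) z, f) + B₂ t k ν' (castT (cubic d (lev L k * evenPeriod t)) z, f) : ℝ) : ℂ)) atTop (𝓝 s') := by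
    intro k ν' f z
    obtain ⟨s₁, h₁⟩ := hB₁1 k ν' f z
    obtain ⟨s₂, h₂⟩ := hB₂1 k ν' f z
    exact ⟨s₁ + s₂, (h₁.add h₂).congr fun t => (Complex.ofReal_add _ _).symm⟩
  obtain ⟨κ₁, C₁, C₁', hκ₁, -, -, P₁, hI₁, hU₁, -, -, hr₁⟩ := conv_deriv_deriv_invCov_expChart₂_of_tendsto L a ha hL hd hne hA hB₁ hA1 hB₁1
  obtain ⟨κ₂, C₂, C₂', hκ₂, -, -, P₂, hI₂, hU₂, -, -, hr₂⟩ := conv_deriv_deriv_invCov_expChart₂_of_tendsto L a ha hL hd hne hA hB₂ hA1 hB₂1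
  obtain ⟨κ₁₂, C₁₂, C₁₂', hκ₁₂, -, -, P₁₂, hI₁₂, -, -, -, hr₁₂⟩ := conv_deriv_deriv_invCov_expChart₂_of_tendsto L a ha hL hd hne hA' hB hA1 hB1
  have hadd := hessianMoments_add_right L a ha hI₁ hI₂ hI₁₂ hU₁ (div_pos hκ₁ hd0) hU₂ (div_pos hκ₂ hd0)
  exact ⟨P₁, P₂, P₁₂, hI₁, hI₂, hI₁₂, hadd.1, hadd.2 hθ0 hθ1 hr₁ hr₂ hr₁₂⟩

end End

end Summit.QuantumFields.BalabanUV.Beta.GAN24.ExponentialChartHessianMomentsEnd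

end
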